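import Summits.ResolutionOfSingularities.ResolutionOfSingularities.Theorems.FrobeniusLadderFRationalResolutionOneSopQuotient
import Summits.ResolutionOfSingularities.ResolutionOfSingularities.Theorems.FrobeniusLadderFRationalResolutionGorensteinSector
import HarnessLib

/-!
# Integral hypersurface germs: ONE tightly closed parameter ideal ⇒ every ideal is tightly closed

Support file for crux stmt-ResolutionOfSingularities-15317 (`FrobeniusLadder.FRationalResolution`),
line `Sketch`, stub `weaklyFRegular_hypersurface_of_one_sop` (wave 7). For a regular local ring `S`
of prime characteristic `p` and `0 ≠ g ∈ 𝔪_S` with `(g)` prime (an INTEGRAL hypersurface germ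
`S/(g)`), weak F-regularity of `S/(g)` is ONE tight-closure test: if one ideal generated by a system
of parameters of `S/(g)` satisfies the tight-closure clause, then EVERY ideal of `S/(g)` does.

Composition of two landed theorems:

* `fRationalClause_of_one_quotient` (Hochster–Huneke 1994, Prop. 6.27 (a), for quotients `S/Q` of
  regular local rings): one tightly closed parameter ideal ⇒ the whole F-rational clause;
* `weaklyFRegular_of_fRational_hypersurface` (rung 3½ on hypersurfaces, Fedder–Watanabe 1989 /
  Hochster–Huneke 1994 for Gorenstein rings): F-rational hypersurface germs are weakly F-regular.

## References

* M. Hochster, C. Huneke, *F-regularity, test elements, and smooth base change*, Trans. AMS 346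
  (1994), Thm. 4.2, Prop. 6.27 (a). [HochsterHuneke1994]
* R. Fedder, K.-i. Watanabe, *A characterization of F-regularity in terms of F-purity*, in
  Commutative Algebra, MSRI Publ. 15 (1989), Prop. 2.2.
-/

-- single-problem summit: the doubled namespace component is forced
set_option linter.dupNamespace false

open IsLocalRing Literature.RingTheory.TightClosure Literature.AlgebraicGeometry.Resolution

namespace Summit.ResolutionOfSingularities.ResolutionOfSingularities.Theorems.FRationalResolution

/-- **INTEGRAL HYPERSURFACE GERMS: WEAK F-REGULARITY IS ONE TIGHT-CLOSURE TEST.** Let `S` be a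
regular local ring of prime characteristic `p`, `0 ≠ g ∈ 𝔪_S` with `(g)` prime. If ONE system of
parameters `s₀` of `S/(g)` (`dim S/(g)` elements generating an ideal with maximal radical) generates
an ideal satisfying the tight-closure clause (`c ≠ 0`, `c y^q ∈ (s₀)^[q]` for all `q = p^e` ⇒
`y ∈ (s₀)`), then EVERY ideal `I` of `S/(g)` satisfies it (the weakly-F-regular clause of rungs
3½/4′): `fRationalClause_of_one_quotient` (HH94 Prop. 6.27 (a) for `S/Q`) upgrades the one test to
the F-rational clause, and `weaklyFRegular_of_fRational_hypersurface` (rung 3½ on hypersurfaces)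
upgrades F-rational to weakly F-regular. [cite: HochsterHuneke1994, Prop. 6.27 (a), Thm. 4.2] -/
theorem weaklyFRegular_hypersurface_of_one_sop (p : ℕ) [Fact p.Prime] (S : Type) [CommRing S]
    [IsRegularLocalRing S] [CharP S p] (g : S) (hg : g ∈ IsLocalRing.maximalIdeal S) (hg0 : g ≠ 0)
    (hprime : (Ideal.span {g}).IsPrime) {d₀ : ℕ} (hd₀ : ringKrullDim (S ⧸ Ideal.span {g}) = d₀)
    (s₀ : Fin d₀ → S ⧸ Ideal.span {g}) (hs₀ : (Ideal.span (Set.range s₀)).radical.IsMaximal)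
    (htc₀ : ∀ y c : S ⧸ Ideal.span {g}, c ≠ 0 → (∀ e : ℕ, c * y ^ p ^ e ∈
      Ideal.span ((fun z : S ⧸ Ideal.span {g} => z ^ p ^ e) ''
        (Ideal.span (Set.range s₀) : Set (S ⧸ Ideal.span {g})))) → y ∈ Ideal.span (Set.range s₀))
    (I : Ideal (S ⧸ Ideal.span {g})) (y c : S ⧸ Ideal.span {g}) (hc : c ≠ 0)
    (hy : ∀ e : ℕ, c * y ^ p ^ e ∈
      Ideal.span ((fun z : S ⧸ Ideal.span {g} => z ^ p ^ e) '' (I : Set (S ⧸ Ideal.span {g})))) :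
    y ∈ I := by
  haveI := hprime
  have htop : Ideal.span {g} ≠ ⊤ := hprime.ne_top
  haveI : Nontrivial (S ⧸ Ideal.span {g}) := Ideal.Quotient.nontrivial_iff.mpr htop
  haveI : IsLocalRing (S ⧸ Ideal.span {g}) := .of_surjective' _ Ideal.Quotient.mk_surjective
  have hFR := fRationalClause_of_one_quotient p S (Ideal.span {g}) hd₀ s₀ hs₀ htc₀
  exact weaklyFRegular_of_fRational_hypersurface p S g hg hg0 hFR I y c hc hy

end Summit.ResolutionOfSingularities.ResolutionOfSingularities.Theorems.FRationalResolution
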